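import Literature.AnabelianGeometry.AbsoluteAnabelian.AbsTopIII.Thm19KummerContainerLemmas
import HarnessLib

/-!
# [AbsTopIII] Thm. 1.9 (d): the Kummer container IS a directed system (functoriality of the pull-backs)

Mochizuki, *Topics in Absolute Anabelian Geometry III*, §1, Theorem 1.9 (d), manuscript pp. 37–38
(lit key `paper:url-5493eb38cbb7`): "`lim_{→V} H¹(Π_V, μ_Ẑ(Π_U))` — where `V` ranges over the open
subschemes obtained by removing finite collections of NF-points from `Z ×_{k_Z} k′`".

Proof-only companion of abc-iut-w5-d213's `Thm19KummerContainer.lean` (p414838) /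
`Thm19KummerContainerLemmas.lean` (p416289) (sub-DAG `plan/L4/SUBDAG-AbsTopIII-Thm19.md`, rows
Thm19.d.r7–r8; cell abc-iut).  The container `NFComplementSystem.kummerContainer` is Mathlib's
`AddCommGroup.DirectLimit` of the levels `H¹(Π_{V_i}, M_Z)` along the pull-backs
`NFComplementSystem.transition`; every exactness statement about it (e.g. the landed
`toContainer_eq_zero_iff`, and the injectivity row `Thm19d_inj`) needs the `DirectedSystem` instance —
`transition i i = id` and `transition j k ∘ transition i j = transition i k` — which the interface
fields `trans_refl` / `trans_trans` of the directed system give through the FUNCTORIALITY OF CONTINUOUS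
COHOMOLOGY in the group (Mathlib `ContinuousCohomology.map_id` / `map_comp`).  This file proves it:

* `cyclotomeModH1Pull_eq_id`, `cyclotomeModH1Pull_comp` — the pull-back `H¹(Π_V, M_X(Λ)) → H¹(Π_{V′}, M_X(Λ))`
  of `Thm19Steps.lean` is functorial in the homomorphism of extensions;
* `NFComplementSystem.transition_self`, `NFComplementSystem.transition_transition`, the `DirectedSystem`
  structure as a THEOREM `NFComplementSystem.directedSystem` (use `haveI := S.directedSystem`; no global
  instance is declared), and the hypothesis-free exactness lemmas `toContainer_eq_zero_iff'`,
  `toContainer_eq_toContainer_iff`.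

No definition of mathematical content, no named fact; nothing here bears on [IUTchIII] Cor. 3.12.
-/

noncomputable section

open CategoryTheory

namespace Literature.AnabelianGeometry.AbsoluteAnabelian.AbsTopIII

universe u

/-! ### Functoriality of the pull-back on `H¹` -/

section PullFunctorial

variable {E''' E'' E' E : FundamentalExtension.{u}} (Λ : Type u) [AddCommGroup Λ] [TopologicalSpace Λ]
  [IsTopologicalAddGroup Λ]

/-- Pull-back along the identity homomorphism of extensions is the identity of `H¹(Π_V, M_X(Λ))`.
[cite: MochizukiAbsTopIII2015, Thm 1.9 (d) p.37] -/
theorem cyclotomeModH1Pull_eq_id {φ : E' ⟶ E'} (hφ : φ = 𝟙 E') (r : E' ⟶ E) (h : φ ≫ r = r) :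
    cyclotomeModH1Pull Λ φ r r h = 𝟙 (cyclotomeModH1 r Λ) := by
  subst hφ
  unfold cyclotomeModH1Pull
  rw [contCohomologyMap_congr FundamentalExtension.id_arith (cyclotomeResCompHom Λ (𝟙 E') r r h)
    (𝟙 _) rfl 1]
  exact ContinuousCohomology.map_id _ 1

/-- Pull-back along a composite `ψ ≫ φ` is the composite of the pull-backs (contravariance of
continuous cohomology in the group). [cite: MochizukiAbsTopIII2015, Thm 1.9 (d) p.37] -/
theorem cyclotomeModH1Pull_comp (φ : E'' ⟶ E') (ψ : E''' ⟶ E'') (r : E' ⟶ E) (r' : E'' ⟶ E)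
    (r'' : E''' ⟶ E) (h : φ ≫ r = r') (h' : ψ ≫ r' = r'') {χ : E''' ⟶ E'} (hχ : χ = ψ ≫ φ)
    (hχr : χ ≫ r = r'') :
    cyclotomeModH1Pull Λ χ r r'' hχr =
      cyclotomeModH1Pull Λ φ r r' h ≫ cyclotomeModH1Pull Λ ψ r' r'' h' := by
  subst hχ
  unfold cyclotomeModH1Pull
  rw [← ContinuousCohomology.map_comp]
  exact contCohomologyMap_congr (FundamentalExtension.comp_arith ψ φ) _ _ rfl 1

end PullFunctorial

/-! ### The transitions of the Kummer container form a directed system -/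

namespace CurveModel.NFComplementSystem

variable {M : CurveModel.{u}} {Z : M.Curve} {ι : Type u} [Preorder ι] (S : NFComplementSystem M Z ι)

/-- `transition i i = id` (from `trans_refl`). [cite: MochizukiAbsTopIII2015, Thm 1.9 (d) p.37] -/
theorem transition_self (i : ι) (η : S.H1 i) : S.transition i i le_rfl η = η := by
  have hE := cyclotomeModH1Pull_eq_id ZHatCoeff.{u} (S.trans_refl i) (S.toZ i)
    (S.trans_comm (le_refl i))
  change (cyclotomeModH1Pull ZHatCoeff.{u} (S.trans (le_refl i)) (S.toZ i) (S.toZ i)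
    (S.trans_comm (le_refl i))).hom η = η
  rw [hE]
  rfl

/-- `transition j k ∘ transition i j = transition i k` (from `trans_trans`).
[cite: MochizukiAbsTopIII2015, Thm 1.9 (d) p.37] -/
theorem transition_transition {i j k : ι} (hij : i ≤ j) (hjk : j ≤ k) (η : S.H1 i) :
    S.transition j k hjk (S.transition i j hij η) = S.transition i k (hij.trans hjk) η := by
  have hE := cyclotomeModH1Pull_comp ZHatCoeff.{u} (S.trans hij) (S.trans hjk) (S.toZ i) (S.toZ j)
    (S.toZ k) (S.trans_comm hij) (S.trans_comm hjk) (S.trans_trans hij hjk)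
    (S.trans_comm (hij.trans hjk))
  change (cyclotomeModH1Pull ZHatCoeff.{u} (S.trans hjk) (S.toZ j) (S.toZ k) (S.trans_comm hjk)).hom
      ((cyclotomeModH1Pull ZHatCoeff.{u} (S.trans hij) (S.toZ i) (S.toZ j) (S.trans_comm hij)).hom η) =
    (cyclotomeModH1Pull ZHatCoeff.{u} (S.trans (hij.trans hjk)) (S.toZ i) (S.toZ k)
      (S.trans_comm (hij.trans hjk))).hom η
  rw [hE]
  rfl

/-- **The levels `H¹(Π_{V_i}, M_Z)` with the pull-backs form a directed system** (so that Mathlib's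
exactness lemmas for `AddCommGroup.DirectLimit` apply to the Kummer container
`lim_{→V} H¹(Π_V, μ_Ẑ(Π_U))`). [cite: MochizukiAbsTopIII2015, Thm 1.9 (d) p.37] -/
theorem directedSystem : DirectedSystem (fun i => S.H1 i) fun i j h => S.transition i j h where
  map_self := fun i η => S.transition_self i η
  map_map := fun _ _ _ hij hjk η => S.transition_transition hij hjk η

/-- Vanishing in the container is vanishing at some later level — `toContainer_eq_zero_iff` of
`Thm19KummerContainerLemmas.lean` with its `DirectedSystem` hypothesis DISCHARGED.
[cite: MochizukiAbsTopIII2015, Thm 1.9 (d) p.37] -/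
theorem toContainer_eq_zero_iff' [IsDirectedOrder ι] {i : ι} (η : S.H1 i) :
    S.toContainer i η = 0 ↔ ∃ (j : ι) (h : i ≤ j), S.transition i j h η = 0 :=
  haveI := S.directedSystem
  S.toContainer_eq_zero_iff η

/-- Two classes of levels `i`, `j` agree in the container iff they agree at some common later level.
[cite: MochizukiAbsTopIII2015, Thm 1.9 (d) p.37] -/
theorem toContainer_eq_toContainer_iff [IsDirectedOrder ι] {i j : ι} (η : S.H1 i) (θ : S.H1 j) :
    S.toContainer i η = S.toContainer j θ ↔
      ∃ (k : ι) (hi : i ≤ k) (hj : j ≤ k), S.transition i k hi η = S.transition j k hj θ := by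
  constructor
  · intro h
    obtain ⟨k, hik, hjk⟩ := exists_ge_ge i j
    have h0 : S.toContainer k (S.transition i k hik η - S.transition j k hjk θ) = 0 := by
      rw [map_sub, S.toContainer_transition hik, S.toContainer_transition hjk, h, sub_self]
    obtain ⟨l, hkl, hl⟩ := (S.toContainer_eq_zero_iff' _).1 h0
    refine ⟨l, hik.trans hkl, hjk.trans hkl, ?_⟩
    rwa [map_sub, S.transition_transition hik hkl, S.transition_transition hjk hkl, sub_eq_zero] at hl
  · rintro ⟨k, hi, hj, hk⟩
    rw [← S.toContainer_transition hi, ← S.toContainer_transition hj, hk]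

end CurveModel.NFComplementSystem

end Literature.AnabelianGeometry.AbsoluteAnabelian.AbsTopIII
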